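import Literature.Probability.Percolation.GladkovThreePointBoundWeighted
import HarnessLib

/-!
# Gladkov's second three-point bound `P(abc)² ≤ 2 P(ab ∪ ac)² P(bc)` (Gladkov 2024, Thm. 6.2 (14))

Topic `Literature/Probability/Percolation`. Proofs-only companion of `GladkovThreePointBound.lean`
(the named fact `gladkov2024_thm_6_2` = inequality (13), discharged in
`GladkovThreePointBoundProofs.lean`; weighted form `GladkovThreePointBoundWeighted.lean`), whose
module docstring lists inequality (14) as "not vendored". Everything here is PROVED; no named fact
is introduced.

Source: N. Gladkov, *Percolation Inequalities and Decision Trees*, arXiv:2408.08457v2 (2024)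
[Gladkov2024]. **Theorem 6.2** (p. 8): "For Bernoulli bond percolation on a graph `G` with vertices
`a, b, c` one has `P(abc)² ≤ 8 P(ab) P(ac) P(bc)` (13) and `P(abc)² ≤ 2 P(ab ∪ ac)² P(bc)`. (14)"
Standing assumptions (p. 1): "`G = (V, E)` a locally finite connected simple graph and `P` is the
probability in a Bernoulli bond percolation model where each edge `e ∈ E` is assigned a probability
`p_e` of being open." Printed proof of (14) (§6.2, p. 9), quoted: "Assume `G` is finite. We first
prove the inequality (14). Let tree `T` perform a DFS starting with the vertex `a` and put the
edges it meets in `S`. With probability `P(a|b ∪ a|c)`, the tree queries the whole component of `a`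
in `C₁` since it does not contain `b` or `c`. After reaching `b` or `c`, the tree `T` stops (and so
puts the rest of the edges in `S̄`). Backtracking the DFS order leaves us with a path `P` from `a`
to either `b` or `c`. … Consider the tree `T′` continuing `T` that reveals the remaining edges
putting them in `S̄` and so is able to decide the event `abc`. Now, by Theorem 5.2 applied to the
trees `T` and `T′` and the events `ab ∪ ac` and `abc`,
`P(C₁ ∈ abc, C₁ →_S C₂ ∈ abc) ≥ P(abc)²/P(ab ∪ ac)`. On the other hand, as in the previous proof,
`P(C₁ ∈ abc, C₁ →_S C₂ ∈ abc)` is bounded from above by `2 P(ab ∪ ac) P(bc)`, by Theorem 4.3. It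
proves the inequality in the form (14). … For infinite `G`, both (14) and (13) follows by passing
to the limit."

The formalisation follows this proof with the machinery already in the tree: the exploration tree
`Gladkov.dfsTree` and its events `R_b`, `R_c` (`Gladkov.R`; `R_b ∪ R_c` is decided by the tree,
`Gladkov.localOn_R`, contains `{a ↔ b} ∩ {a ↔ c}` on configurations inside `D`,
`Gladkov.mem_R_or_mem_R_of_mem_conn`, and is contained in `{a ↔ b} ∪ {a ↔ c}`,
`Gladkov.mem_conn_of_mem_R` — this is the printed "`P(R_b) + P(R_c) = P(ab ∪ ac)`" in the
inequality form that is used), Theorem 5.2 (`DecisionTree.sq_PrW_le_PrW_mul_Pr2W_bothIn`), the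
path surgery "as in the previous proof" (`Gladkov.mem_treeDsq_union`: on
`{C₁ ∈ R_t ∩ abc, C₁ →_S C₂ ∈ abc}` the pair lies in `(t′a □_S t′t) ∪ (t′t □_S t′a)`, `t′` the other
target) followed by the monotonicity `t′a ⊆ ab ∪ ac`, `t′t = bc` of disjoint occurrence
(`Gladkov.treeDsq_mono`), and Theorem 4.3 (`DecisionTree.Pr2W_treeDsq_le`) twice. The passage to
the limit for infinite `G` is the one of `gladkov2024_thm_6_2_holds` (exhaustion `D_n ↑ E(G)`,
`{u ↔ v} = ⋃_n {u ↔ v through D_n}` off a null set, continuity from below).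

## Contents

* `Gladkov.localOn_union`, `Gladkov.dsqWith_mono`, `Gladkov.treeDsq_mono` — API (unions of decided
  events are decided; `A □_S B` is monotone in `A`, `B`).
* `Gladkov.mem_treeDsq_union_targets` — the surgery for (14): on
  `{C₁ ∈ abc ∩ (R_b ∪ R_c), C₁ →_S C₂ ∈ abc}`, `(C₁, C₂) ∈ ((ab ∪ ac) □_S bc) ∪ (bc □_S (ab ∪ ac))`.
* `Gladkov.sq_PrW_conn_inter_conn_le_union` — **(14) for weighted configurations among a finite
  edge set `D`** (each edge `e` open with its own probability `p_e`); `Gladkov.sq_Pr_conn_inter_conn_le_union`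
  — the homogeneous specialisation; `Gladkov.sq_real_connD_le_union` — (14) for `bondPercolation G p`
  through a finite `D ⊆ E(G)`.
* `gladkov2024_thm_6_2_ineq14_prodBernoulli` — **(14) for `prodBernoulli w` on a finite vertex type**
  (the cell vocabulary of `gladkov2024_thm_1_1_prodBernoulli`, `gladkovZimin2024_threePoint_prodBernoulli`,
  `prodBernoulli_threePoint_strongHarris`), distinct `a, b, c`; primed version for arbitrary
  `a, b, c` (the coincident cases are trivial, as Thm. 6.2 is printed without distinctness).
* `gladkov2024_thm_6_2_ineq14` — **(14) for the homogeneous `bondPercolation G p` on a locally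
  finite connected graph** (the generality of the fact `gladkov2024_thm_6_2`), by passage to the limit.

## Transcription notes

* As for (13): `P(abc)` = `μ.real (openConn a b ∩ openConn a c)`, `P(ab ∪ ac)` =
  `μ.real (openConn a b ∪ openConn a c)`, `P(bc)` = `μ.real (openConn b c)`; inhomogeneous `p_e`
  on finite graphs (`prodBernoulli w`, all pairs of a finite vertex type as coordinates — a pair of
  weight `0` is a closed non-edge), homogeneous `p` in infinite volume (the tree's `bondPercolation`).
* A second, independent formalisation of (14) for finite multigraphs exists in the venture
  `Summits/Ventures/PercRepro/GladkovThm62.lean` (`PercRepro.MultiGraph.gladkov_thm62`, venture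
  vocabulary `PercRepro.prob`/`connEvent`); `Literature/` cannot import it and the percolation
  files of this topic speak `prodBernoulli`/`bondPercolation`/`openConn`, hence this file.
* Not vendored here: the planar constant-`2` bound (Thm. 6.1), Remarks 6.3/6.4 (sharpenings via
  Thm. 8.3 / PDFS).

## References

* N. Gladkov, *Percolation Inequalities and Decision Trees*, arXiv:2408.08457v2 (2024): Thm. 6.2
  (13)–(14) (p. 8), proof §6.2 (p. 9), Thm. 4.3 (p. 5), Thm. 5.2 (p. 6). [Gladkov2024]
-/

noncomputable section

namespace Literature.Probability.Percolation

namespace Gladkov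

open Finset DecisionTree

/-! ### API: unions of decided events, monotonicity of `□_S` -/

section API

variable {ι : Type*} [DecidableEq ι]

omit [DecidableEq ι] in
/-- The union of two events decided on `Fm` is decided on `Fm` (immediate from the definition of
"`T` decides `A`"). [cite: Gladkov2024, Def. 5.1 (T decides A), p. 6] -/
theorem localOn_union {Fm : Finset ι → Finset ι} {A B : Set (Finset ι)} (hA : LocalOn Fm A)
    (hB : LocalOn Fm B) : LocalOn Fm (A ∪ B) := fun K K' h hK =>
  hK.elim (fun h₁ => Or.inl (hA K K' h h₁)) fun h₂ => Or.inr (hB K K' h h₂)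

/-- `A □_S B` is monotone in `A` and `B`: a witness of a sub-event is a witness of the event
(immediate from the definitions of witnesses and of `A □_S B`).
[cite: Gladkov2024, Def. 4.1–4.2 (witnesses, A □_S B), p. 5] -/
theorem dsqWith_mono (S : Finset ι) {A A' B B' : Set (Finset ι)} (hA : A ⊆ A') (hB : B ⊆ B') :
    dsqWith S A B ⊆ dsqWith S A' B' := by
  rintro x ⟨I, J, hI, hIA, hJ, hJB, hIJ⟩
  exact ⟨I, J, hI, hA hIA, hJ, hB hJB, hIJ⟩

/-- `A □_S B`, with `S` built by a tree, is monotone in `A` and `B` (immediate from the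
definition). [cite: Gladkov2024, Def. 4.2 (A □_S B), p. 5] -/
theorem treeDsq_mono (S₀ : Finset ι) (T : DTree ι) {A A' B B' : Set (Finset ι)} (hA : A ⊆ A')
    (hB : B ⊆ B') : treeDsq S₀ T A B ⊆ treeDsq S₀ T A' B' := fun x hx =>
  dsqWith_mono (S₀ ∪ revealed T x.1) hA hB hx

end API

variable {V : Type*} [DecidableEq V] {D : Finset (Sym2 V)} {a b c : V}

/-! ### The surgery for (14) -/

/-- **The path surgery for (14).** Let `C₁ ∈ {a ↔ b} ∩ {a ↔ c}` lie in `R_b ∪ R_c` (the exploration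
from `a` stopped at a target `t`, the other target `t′` unvisited) and let `C₃ := C₁ →_S C₂` also
join `a` to `b` and to `c`. By the surgery of §6.1 (16) / §6.2 (`mem_treeDsq_union`),
`(C₁, C₂) ∈ (t′a □_S t′t) ∪ (t′t □_S t′a)`; since `{t′ ↔ a} ⊆ {a ↔ b} ∪ {a ↔ c}` and
`{t′ ↔ t} = {b ↔ c}`, `(C₁, C₂) ∈ ((ab ∪ ac) □_S bc) ∪ (bc □_S (ab ∪ ac))` ("as in the previous
proof", applied with the events `ab ∪ ac` and `bc`). [cite: Gladkov2024, §6.2 (proof of (14), p. 9)] -/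
theorem mem_treeDsq_union_targets (hab : a ≠ b) (hac : a ≠ c) (hbc : b ≠ c)
    {K₁ K₂ : Finset (Sym2 V)} (hK₁ : K₁ ⊆ D) (hK₂ : K₂ ⊆ D)
    (hR : K₁ ∈ R D a b c b ∪ R D a b c c) (h1 : K₁ ∈ conn a b ∩ conn a c)
    (h3 : splice (revealed (dfsTree D a b c) K₁) K₁ K₂ ∈ conn a b ∩ conn a c) :
    (K₁, K₂) ∈ treeDsq ∅ (dfsTree D a b c) (conn a b ∪ conn a c) (conn b c) ∪
      treeDsq ∅ (dfsTree D a b c) (conn b c) (conn a b ∪ conn a c) := by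
  rcases hR with hR | hR
  · -- the exploration stopped at `b`; the third vertex is `c`
    have hcvis : c ∉ (fin D a b c K₁).vis := by
      obtain ⟨rest, -, h⟩ := stack_of_mem_R hab hac hbc hR
      rcases h with ⟨-, h⟩ | ⟨h, -⟩
      · exact h
      · exact absurd h hbc
    have h := mem_treeDsq_union hab hac hbc hK₁ hK₂ hR hcvis h1.2 h3.2
    rw [conn_comm c a, conn_comm c b] at h
    exact h.imp (fun h => treeDsq_mono _ _ Set.subset_union_right subset_rfl h)
      fun h => treeDsq_mono _ _ subset_rfl Set.subset_union_right h
  · -- the exploration stopped at `c`; the third vertex is `b`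
    have hbvis : b ∉ (fin D a b c K₁).vis := by
      obtain ⟨rest, -, h⟩ := stack_of_mem_R hab hac hbc hR
      rcases h with ⟨h, -⟩ | ⟨-, h⟩
      · exact absurd h.symm hbc
      · exact h
    have h := mem_treeDsq_union hab hac hbc hK₁ hK₂ hR hbvis h1.1 h3.1
    rw [conn_comm b a] at h
    exact h.imp (fun h => treeDsq_mono _ _ Set.subset_union_left subset_rfl h)
      fun h => treeDsq_mono _ _ subset_rfl Set.subset_union_left h

/-! ### (14) in finite volume -/

/-- **Gladkov 2024, Theorem 6.2 (14), finite case with inhomogeneous weights**: for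
configurations of open edges among a finite set `D` of edges, each edge `e` open with its own
probability `p_e ∈ [0, 1]`, and distinct vertices `a, b, c`,
`P(a ↔ b, a ↔ c)² ≤ 2 P(a ↔ b or a ↔ c)² P(b ↔ c)`. Proof as printed: with `A = R_b ∪ R_c`
(decided by the tree, `A ⊆ ab ∪ ac`) and `B = abc ∩ A` (`= abc` on `D`), Theorem 5.2 gives
`P(B)² ≤ P(A) · P(C₁ ∈ B, C₁ →_S C₂ ∈ B)`, and the surgery with Theorem 4.3 gives
`P(C₁ ∈ B, C₁ →_S C₂ ∈ B) ≤ P((ab ∪ ac) □_S bc) + P(bc □_S (ab ∪ ac)) ≤ 2 P(ab ∪ ac) P(bc)`.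
[cite: Gladkov2024, Thm. 6.2 (14) (finite G, arbitrary p_e), proof §6.2 p. 9] -/
theorem sq_PrW_conn_inter_conn_le_union (D : Finset (Sym2 V)) {p : Sym2 V → ℝ}
    (hp0 : ∀ i, 0 ≤ p i) (hp1 : ∀ i, p i ≤ 1) {a b c : V} (hab : a ≠ b) (hac : a ≠ c)
    (hbc : b ≠ c) :
    PrW D p (conn a b ∩ conn a c) ^ 2 ≤
      2 * PrW D p (conn a b ∪ conn a c) ^ 2 * PrW D p (conn b c) := by
  set U := conn a b ∪ conn a c with hU
  set A := R D a b c b ∪ R D a b c c with hA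
  set B := conn a b ∩ conn a c ∩ A with hB
  have hBA : B ⊆ A := Set.inter_subset_right
  have hSD := selfDetermined_revealed (dfsTree D a b c)
  have hlocA : LocalOn (revealed (dfsTree D a b c)) A :=
    localOn_union (localOn_R (D := D) (a := a) (b := b) (c := c) b)
      (localOn_R (D := D) (a := a) (b := b) (c := c) c)
  have hUup : IsUpperSet U := (isUpperSet_conn a b).union (isUpperSet_conn a c)
  -- Theorem 5.2 with the events `A` (decided by `T`) and `B ⊆ A`
  have h52 := sq_PrW_le_PrW_mul_Pr2W_bothIn D hp0 hp1 hSD hlocA hBA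
  -- `P(abc) ≤ P(B)`: inside `D`, `abc ⊆ ab ⊆ R_b ∪ R_c`
  have hPB : PrW D p (conn a b ∩ conn a c) ≤ PrW D p B :=
    PrW_mono D hp0 hp1 fun K hKD hK =>
      ⟨hK, mem_R_or_mem_R_of_mem_conn hab hac hbc hKD (Or.inl rfl) hK.1⟩
  -- `P(R_b ∪ R_c) ≤ P(ab ∪ ac)`
  have hPA : PrW D p A ≤ PrW D p U :=
    PrW_mono D hp0 hp1 fun K _ hK => hK.elim (fun h => Or.inl (mem_conn_of_mem_R hab hac hbc h))
      fun h => Or.inr (mem_conn_of_mem_R hab hac hbc h)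
  -- surgery + Theorem 4.3
  have hE : Pr2W D p (bothIn (revealed (dfsTree D a b c)) B) ≤ 2 * PrW D p U * PrW D p (conn b c) := by
    have hsub : ∀ x : Finset (Sym2 V) × Finset (Sym2 V), x.1 ⊆ D → x.2 ⊆ D →
        x ∈ bothIn (revealed (dfsTree D a b c)) B →
          x ∈ treeDsq ∅ (dfsTree D a b c) U (conn b c) ∪ treeDsq ∅ (dfsTree D a b c) (conn b c) U := by
      rintro ⟨K₁, K₂⟩ hK₁ hK₂ ⟨hK₁B, hK₃B⟩
      exact mem_treeDsq_union_targets hab hac hbc hK₁ hK₂ hK₁B.2 hK₁B.1 hK₃B.1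
    calc Pr2W D p (bothIn (revealed (dfsTree D a b c)) B)
        ≤ Pr2W D p (treeDsq ∅ (dfsTree D a b c) U (conn b c) ∪
            treeDsq ∅ (dfsTree D a b c) (conn b c) U) := Pr2W_mono D hp0 hp1 hsub
      _ ≤ Pr2W D p (treeDsq ∅ (dfsTree D a b c) U (conn b c)) +
            Pr2W D p (treeDsq ∅ (dfsTree D a b c) (conn b c) U) := Pr2W_union_le D hp0 hp1 _ _
      _ ≤ PrW D p U * PrW D p (conn b c) + PrW D p (conn b c) * PrW D p U :=
          add_le_add (Pr2W_treeDsq_le D hp0 hp1 _ hUup (isUpperSet_conn _ _))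
            (Pr2W_treeDsq_le D hp0 hp1 _ (isUpperSet_conn _ _) hUup)
      _ = 2 * PrW D p U * PrW D p (conn b c) := by ring
  have h0 : 0 ≤ PrW D p (conn a b ∩ conn a c) := PrW_nonneg D hp0 hp1 _
  calc PrW D p (conn a b ∩ conn a c) ^ 2 ≤ PrW D p B ^ 2 := pow_le_pow_left₀ h0 hPB 2
    _ ≤ PrW D p A * Pr2W D p (bothIn (revealed (dfsTree D a b c)) B) := h52
    _ ≤ PrW D p U * (2 * PrW D p U * PrW D p (conn b c)) :=
        mul_le_mul hPA hE (Pr2W_nonneg D hp0 hp1 _) (PrW_nonneg D hp0 hp1 _)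
    _ = 2 * PrW D p U ^ 2 * PrW D p (conn b c) := by ring

/-- **Gladkov 2024, Theorem 6.2 (14), finite case, homogeneous density `p`** (the special case
`p_e ≡ p` of `sq_PrW_conn_inter_conn_le_union`, in the vocabulary `DecisionTree.Pr` of
`GladkovThreePointBoundProofs.lean`). [cite: Gladkov2024, Thm. 6.2 (14) (finite G)] -/
theorem sq_Pr_conn_inter_conn_le_union (D : Finset (Sym2 V)) {p : ℝ} (hp0 : 0 ≤ p) (hp1 : p ≤ 1)
    {a b c : V} (hab : a ≠ b) (hac : a ≠ c) (hbc : b ≠ c) :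
    Pr D p (conn a b ∩ conn a c) ^ 2 ≤
      2 * Pr D p (conn a b ∪ conn a c) ^ 2 * Pr D p (conn b c) := by
  have h := sq_PrW_conn_inter_conn_le_union D (p := fun _ => p) (fun _ => hp0) (fun _ => hp1)
    hab hac hbc
  simpa only [PrW_const] using h

open MeasureTheory in
omit [DecidableEq V] in
/-- **(14) through a finite edge set**: for `D ⊆ E(G)` finite and distinct `a, b, c`,
`P_p(a ↔ b, a ↔ c through D)² ≤ 2 P_p(a ↔ b or a ↔ c through D)² P_p(b ↔ c through D)`
(law of the finite-dimensional marginal, `Gladkov.real_eq_Pr`). [cite: Gladkov2024, Thm. 6.2 (14) (finite G)] -/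
theorem sq_real_connD_le_union [DecidableEq V] (G : SimpleGraph V) (p : unitInterval)
    {D : Finset (Sym2 V)} (hD : (↑D : Set (Sym2 V)) ⊆ G.edgeSet) {a b c : V} (hab : a ≠ b)
    (hac : a ≠ c) (hbc : b ≠ c) :
    ((bondPercolation G p).real (connD D a b ∩ connD D a c)) ^ 2 ≤
      2 * ((bondPercolation G p).real (connD D a b ∪ connD D a c)) ^ 2 *
        (bondPercolation G p).real (connD D b c) := by
  have h2 : (bondPercolation G p).real (connD D b c) = Pr D (p : ℝ) (conn b c) :=
    real_eq_Pr G p hD (determinedBy_connD D b c) fun S hS => (coe_mem_connD_iff hS b c).symm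
  have h3 : (bondPercolation G p).real (connD D a b ∩ connD D a c) =
      Pr D (p : ℝ) (conn a b ∩ conn a c) :=
    real_eq_Pr G p hD ((determinedBy_connD D a b).inter (determinedBy_connD D a c)) fun S hS => by
      rw [Set.mem_inter_iff, Set.mem_inter_iff, coe_mem_connD_iff hS, coe_mem_connD_iff hS]
  have hdetU : DeterminedBy (connD D a b ∪ connD D a c) (↑D : Set (Sym2 V)) := by
    rw [determinedBy_iff]
    intro ω ω' h
    have hb := (determinedBy_iff _ _).1 (determinedBy_connD D a b) ω ω' h
    have hc := (determinedBy_iff _ _).1 (determinedBy_connD D a c) ω ω' h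
    rw [Set.mem_union, Set.mem_union, hb, hc]
  have h4 : (bondPercolation G p).real (connD D a b ∪ connD D a c) =
      Pr D (p : ℝ) (conn a b ∪ conn a c) :=
    real_eq_Pr G p hD hdetU fun S hS => by
      rw [Set.mem_union, Set.mem_union, coe_mem_connD_iff hS a b, coe_mem_connD_iff hS a c]
  rw [h2, h3, h4]
  exact sq_Pr_conn_inter_conn_le_union D p.2.1 p.2.2 hab hac hbc

end Gladkov

/-! ## (14) for the measures of the tree -/

section Statements

open Gladkov MeasureTheory ProbabilityTheory Filter
open scoped ProbabilityTheory ENNReal Topology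

open Literature.Probability.LatticeModels in
/-- **Gladkov 2024, Theorem 6.2 (14) for finite weighted graphs** (`prodBernoulli w`, each pair `e`
of a finite vertex type open independently with probability `w e` — the printed generality "each
edge `e ∈ E` is assigned a probability `p_e`", p. 2, on the finite complete graph): for distinct
`a, b, c`, `P(a ↔ b, a ↔ c)² ≤ 2 · P(a ↔ b or a ↔ c)² · P(b ↔ c)`. From the finite weighted form
`Gladkov.sq_PrW_conn_inter_conn_le_union` with `D` = all pairs, via the law of the
finite-dimensional marginal `DecisionTree.prodBernoulli_real_eq_PrW`.
[cite: Gladkov2024, Thm. 6.2 (14) (p. 8), proof §6.2 (p. 9), arXiv:2408.08457] -/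
theorem gladkov2024_thm_6_2_ineq14_prodBernoulli {V : Type*} [Fintype V]
    (w : Sym2 V → unitInterval) {a b c : V} (hab : a ≠ b) (hac : a ≠ c) (hbc : b ≠ c) :
    ((prodBernoulli w).real (openConn a b ∩ openConn a c)) ^ 2 ≤
      2 * ((prodBernoulli w).real (openConn a b ∪ openConn a c)) ^ 2 *
        (prodBernoulli w).real (openConn b c) := by
  classical
  set D : Finset (Sym2 V) := Finset.univ with hD
  set p : Sym2 V → ℝ := fun e => (w e : ℝ) with hp
  have hp0 : ∀ e, 0 ≤ p e := fun e => (w e).2.1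
  have hp1 : ∀ e, p e ≤ 1 := fun e => (w e).2.2
  have hdet : ∀ C : Set (BondConfig V), DeterminedBy C (↑D : Set (Sym2 V)) := by
    intro C
    rw [determinedBy_iff]
    intro ω ω' h
    rw [hD, Finset.coe_univ, Set.inter_univ, Set.inter_univ] at h
    rw [h]
  have key : ∀ x y : V,
      (prodBernoulli w).real (openConn x y) = DecisionTree.PrW D p (Gladkov.conn x y) := by
    intro x y
    exact DecisionTree.prodBernoulli_real_eq_PrW w (hdet _) fun S _ => Iff.rfl
  have key2 : (prodBernoulli w).real (openConn a b ∩ openConn a c) =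
      DecisionTree.PrW D p (Gladkov.conn a b ∩ Gladkov.conn a c) :=
    DecisionTree.prodBernoulli_real_eq_PrW w (hdet _) fun S _ => Iff.rfl
  have key3 : (prodBernoulli w).real (openConn a b ∪ openConn a c) =
      DecisionTree.PrW D p (Gladkov.conn a b ∪ Gladkov.conn a c) :=
    DecisionTree.prodBernoulli_real_eq_PrW w (hdet _) fun S _ => Iff.rfl
  rw [key, key2, key3]
  exact Gladkov.sq_PrW_conn_inter_conn_le_union D hp0 hp1 hab hac hbc

open Literature.Probability.LatticeModels in
/-- **Gladkov 2024, Theorem 6.2 (14) for finite weighted graphs, arbitrary `a, b, c`** (Thm. 6.2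
is printed without a distinctness hypothesis; when two of the three vertices coincide the
inequality reads `P(ac)² ≤ 2 P(ac)`, `P(ab)² ≤ 2 P(ab)` or `P(ab)² ≤ 2 P(ab)²`).
[cite: Gladkov2024, Thm. 6.2 (14) (p. 8)] -/
theorem gladkov2024_thm_6_2_ineq14_prodBernoulli' {V : Type*} [Fintype V]
    (w : Sym2 V → unitInterval) (a b c : V) :
    ((prodBernoulli w).real (openConn a b ∩ openConn a c)) ^ 2 ≤
      2 * ((prodBernoulli w).real (openConn a b ∪ openConn a c)) ^ 2 *
        (prodBernoulli w).real (openConn b c) := by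
  set μ := prodBernoulli w with hμ
  have hself : ∀ x : V, (openConn x x : Set (BondConfig V)) = Set.univ := fun x =>
    Set.eq_univ_of_forall fun ω => SimpleGraph.Reachable.refl (G := openGraph ω) x
  have hsymm : ∀ x y : V, (openConn x y : Set (BondConfig V)) = openConn y x := fun x y =>
    Set.ext fun ω => ⟨fun h => SimpleGraph.Reachable.symm h, fun h => SimpleGraph.Reachable.symm h⟩
  have h0 : ∀ X : Set (BondConfig V), 0 ≤ μ.real X := fun X => measureReal_nonneg
  have h1 : ∀ X : Set (BondConfig V), μ.real X ≤ 1 := fun X => measureReal_le_one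
  by_cases hab : a = b
  · subst hab
    rw [hself, Set.univ_inter, Set.univ_union, probReal_univ]
    nlinarith [h0 (openConn a c), h1 (openConn a c)]
  by_cases hac : a = c
  · subst hac
    rw [hself, Set.inter_univ, Set.union_univ, probReal_univ, hsymm b a]
    nlinarith [h0 (openConn a b), h1 (openConn a b)]
  by_cases hbc : b = c
  · subst hbc
    rw [Set.inter_self, Set.union_self, hself, probReal_univ]
    nlinarith [h0 (openConn a b), h1 (openConn a b), sq_nonneg (μ.real (openConn a b))]
  exact gladkov2024_thm_6_2_ineq14_prodBernoulli w hab hac hbc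

/-- **Gladkov 2024, Theorem 6.2 (14)** for Bernoulli bond percolation with edge density
`p ∈ [0, 1]` on a locally finite connected simple graph `G` and distinct vertices `a, b, c`:
`P_p(a, b, c in one open cluster)² ≤ 2 · P_p(a ↔ b or a ↔ c)² · P_p(b ↔ c)` — the generality of the
tree's fact `gladkov2024_thm_6_2` (= (13)); printed for edge-dependent `p_e`, recorded for the
homogeneous `bondPercolation G p`. Finite case `Gladkov.sq_real_connD_le_union`, then `D ↑ E(G)`
("for infinite `G`, both (14) and (13) follows by passing to the limit").
[cite: Gladkov2024, Thm. 6.2 (14) (p. 8), proof §6.2 (p. 9–10), arXiv:2408.08457] -/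
theorem gladkov2024_thm_6_2_ineq14 {V : Type*} (G : SimpleGraph V) [G.LocallyFinite]
    (hconn : G.Connected) (p : unitInterval) (a b c : V) (hab : a ≠ b) (hac : a ≠ c)
    (hbc : b ≠ c) :
    ((bondPercolation G p).real (openConn a b ∩ openConn a c)) ^ 2 ≤
      2 * ((bondPercolation G p).real (openConn a b ∪ openConn a c)) ^ 2 *
        (bondPercolation G p).real (openConn b c) := by
  classical
  haveI : Countable V := DCTQ.countable_of_connected hconn a
  haveI : Nonempty (Sym2 V) := ⟨s(a, a)⟩
  set μ := bondPercolation G p with hμ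
  -- an exhaustion of `E(G)` by finite sets
  obtain ⟨f, hf⟩ := exists_surjective_nat (Sym2 V)
  let Dn : ℕ → Finset (Sym2 V) := fun n =>
    ((Finset.range (n + 1)).image f).filter fun e => e ∈ G.edgeSet
  have hDE : ∀ n, (↑(Dn n) : Set (Sym2 V)) ⊆ G.edgeSet := fun n e he => by
    have := Finset.mem_coe.1 he
    exact (Finset.mem_filter.1 this).2
  have hDmono : Monotone Dn := fun n m hnm => by
    refine Finset.filter_subset_filter _ (Finset.image_subset_image ?_)
    exact Finset.range_subset_range.2 (by omega)
  have hDcov : G.edgeSet ⊆ ⋃ n, (↑(Dn n) : Set (Sym2 V)) := fun e he => by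
    obtain ⟨k, rfl⟩ := hf e
    refine Set.mem_iUnion.2 ⟨k, Finset.mem_coe.2 (Finset.mem_filter.2 ⟨?_, he⟩)⟩
    exact Finset.mem_image.2 ⟨k, Finset.mem_range.2 (Nat.lt_succ_self k), rfl⟩
  -- the null set of configurations using non-edges
  have hnull : μ {ω | ω ⊆ G.edgeSet}ᶜ = 0 := by
    have h := setBernoulli_ae_subset (u := G.edgeSet) (p := p)
    rw [Filter.Eventually, mem_ae_iff] at h
    exact h
  -- the approximating events
  have hlim : ∀ {X : Set (Set (Sym2 V))} {Y : ℕ → Set (Set (Sym2 V))}, Monotone Y →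
      (∀ n, Y n ⊆ X) → X ∩ {ω | ω ⊆ G.edgeSet}ᶜᶜ ⊆ (⋃ n, Y n) →
        Tendsto (fun n => μ.real (Y n)) atTop (𝓝 (μ.real X)) := by
    intro X Y hY hYX hXY
    have h1 : μ X = μ (⋃ n, Y n) :=
      measure_eq_of_sandwich hnull (Set.iUnion_subset hYX) hXY
    have h2 := tendsto_measure_iUnion_atTop (μ := μ) hY
    rw [← h1] at h2
    exact (ENNReal.tendsto_toReal (measure_ne_top μ X)).comp h2
  have hmonoD : ∀ u v : V, Monotone fun n => connD (Dn n) u v := fun u v n m hnm =>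
    connD_mono (hDmono hnm) u v
  -- `{u ↔ v} ⊆ ⋃_n {u ↔ v through D_n}` off the null set
  have hcover : ∀ {u v : V} {ω : Set (Sym2 V)}, ω ⊆ G.edgeSet → ∀ w : (openGraph ω).Walk u v,
      ∃ n, ∀ m, n ≤ m → (openGraph (ω ∩ ↑(Dn m))).Reachable u v := by
    intro u v ω hω w
    obtain ⟨n, hn⟩ := exists_edges_subset hDmono (hω.trans hDcov) w.edges.toFinset
      (fun e he => mem_of_mem_walk_edges w (by simpa using he))
    refine ⟨n, fun m hm => reachable_openGraph_of_walk w fun e he => ⟨mem_of_mem_walk_edges w he, ?_⟩⟩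
    exact Finset.coe_subset.2 (hDmono hm) (hn (by simp [he]))
  have htwo : ∀ u v : V,
      Tendsto (fun n => μ.real (connD (Dn n) u v)) atTop (𝓝 (μ.real (openConn u v))) := by
    intro u v
    refine hlim (hmonoD u v) (fun n => connD_subset_openConn _ u v) fun ω ⟨hω, hωE⟩ => ?_
    rw [compl_compl] at hωE
    obtain ⟨w⟩ := (hω : (openGraph ω).Reachable u v)
    obtain ⟨n, hn⟩ := hcover hωE w
    exact Set.mem_iUnion.2 ⟨n, hn n le_rfl⟩
  have hthree : Tendsto (fun n => μ.real (connD (Dn n) a b ∩ connD (Dn n) a c)) atTop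
      (𝓝 (μ.real (openConn a b ∩ openConn a c))) := by
    refine hlim (fun n m hnm => Set.inter_subset_inter (hmonoD a b hnm) (hmonoD a c hnm))
      (fun n => Set.inter_subset_inter (connD_subset_openConn _ a b) (connD_subset_openConn _ a c))
      fun ω ⟨⟨hωb, hωc⟩, hωE⟩ => ?_
    rw [compl_compl] at hωE
    obtain ⟨wb⟩ := (hωb : (openGraph ω).Reachable a b)
    obtain ⟨wc⟩ := (hωc : (openGraph ω).Reachable a c)
    obtain ⟨n, hn⟩ := hcover hωE wb
    obtain ⟨m, hm⟩ := hcover hωE wc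
    exact Set.mem_iUnion.2 ⟨max n m, hn _ (le_max_left _ _), hm _ (le_max_right _ _)⟩
  have hunion : Tendsto (fun n => μ.real (connD (Dn n) a b ∪ connD (Dn n) a c)) atTop
      (𝓝 (μ.real (openConn a b ∪ openConn a c))) := by
    refine hlim (fun n m hnm => Set.union_subset_union (hmonoD a b hnm) (hmonoD a c hnm))
      (fun n => Set.union_subset_union (connD_subset_openConn _ a b) (connD_subset_openConn _ a c))
      fun ω ⟨hω, hωE⟩ => ?_
    rw [compl_compl] at hωE
    rcases hω with hωb | hωc
    · obtain ⟨wb⟩ := (hωb : (openGraph ω).Reachable a b)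
      obtain ⟨n, hn⟩ := hcover hωE wb
      exact Set.mem_iUnion.2 ⟨n, Or.inl (hn n le_rfl)⟩
    · obtain ⟨wc⟩ := (hωc : (openGraph ω).Reachable a c)
      obtain ⟨n, hn⟩ := hcover hωE wc
      exact Set.mem_iUnion.2 ⟨n, Or.inr (hn n le_rfl)⟩
  -- the finite inequalities and the limit
  have hfin : ∀ n, (μ.real (connD (Dn n) a b ∩ connD (Dn n) a c)) ^ 2 ≤
      2 * (μ.real (connD (Dn n) a b ∪ connD (Dn n) a c)) ^ 2 * μ.real (connD (Dn n) b c) :=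
    fun n => sq_real_connD_le_union G p (hDE n) hab hac hbc
  exact le_of_tendsto_of_tendsto' (hthree.pow 2)
    (((hunion.pow 2).const_mul 2).mul (htwo b c)) hfin

/-- **(14) on `ℤ^d`** with the two-point function: for distinct `a, b, c ∈ ℤ^d` and every `p`,
`P_p(a ↔ b, a ↔ c)² ≤ 2 P_p(a ↔ b or a ↔ c)² τ_p(b, c)` (the nearest-neighbour lattice is locally
finite, `LatticeGraph.lean`, and connected, `zdGraph_preconnected_holds`).
[cite: Gladkov2024, Thm. 6.2 (14) (p. 8)] -/
theorem gladkov2024_thm_6_2_ineq14_zd (d : ℕ) (p : unitInterval) (a b c : LatticeModels.Site d)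
    (hab : a ≠ b) (hac : a ≠ c) (hbc : b ≠ c) :
    ((bondPercolation (LatticeModels.zdGraph d) p).real (openConn a b ∩ openConn a c)) ^ 2 ≤
      2 * ((bondPercolation (LatticeModels.zdGraph d) p).real (openConn a b ∪ openConn a c)) ^ 2 *
        tau d p b c := by
  have hconn : (LatticeModels.zdGraph d).Connected :=
    (SimpleGraph.connected_iff _).2 ⟨LatticeModels.zdGraph_preconnected_holds, ⟨0⟩⟩
  simpa only [tau_def] using
    gladkov2024_thm_6_2_ineq14 (LatticeModels.zdGraph d) hconn p a b c hab hac hbc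

end Statements

end Literature.Probability.Percolation

end
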